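import Summits.AtomisticToContinuum.FouriersLaw.Theorems.VanishingNoiseTransferVanishingNoiseBoundJumpPerturbationCore
import Mathlib.Probability.Distributions.Poisson.Basic
import Mathlib.Analysis.SpecialFunctions.Integrals.Basic

/-!
# Jump perturbation of a measurable Markov semigroup, II: the Poisson weights
(brick for crux stmt-AtomisticToContinuum-11976 `VanishingNoiseTransfer.VanishingNoiseBound`, line
`fekete-usc-one-length`, stub S3 `stub_noisyPositiveConductance`; worker file, wave 2)

Step II of the construction of the flip semigroup of `L + εS` as a jump perturbation of the flip-free
transition semigroup (see `…JumpPerturbationCore.lean` for step I and the overview). For an ABSTRACT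
Dyson–Phillips family — any sequence of kernels `U n` from `ℝ × X` to `X` satisfying the two identities
delivered by `exists_dysonPhillips` (`U 0 (t, x) = e^{-rt} P_t(x, ·)` and the last-jump recursion), over
a Markov kernel `K` (the time-extended transition kernel), a Markov jump kernel `Q` and a rate `r > 0` —
this file computes the total masses: `U_n(t, x)(X) = e^{-rt}(rt)^n/n!` (`measure_univ_U`: the Poisson
probability of exactly `n` clock events in `[0, t]`, by induction through the recursion) and hence
`∑_n U_n(t, x)(X) = 1` (`hasSum_measure_univ_U`): the jump expansion `∑_n U_n(t)` is a Markov kernel.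
Also `lintegral_expMeasure_indicator` (`∫ 1_{s<t} g dExp_r = ∫₀ᵗ r e^{-rs} g ds`) and
`setLIntegral_mul_sub_pow` (`∫₀ᵗ c (t-s)^n ds = c t^{n+1}/(n+1)`).

No definitions. Registered sub-goal: `helper_dysonPhillipsMass` (the mass formula on the phase space of
the chain). References: Ethier–Kurtz 1986, Ch. 4 §10; folklore.
-/

noncomputable section

namespace Summit.AtomisticToContinuum.FouriersLaw.Theorems.VanishingNoiseBound.JumpPerturbation

open MeasureTheory ProbabilityTheory Filter Topology Set Function
open scoped NNReal ENNReal

variable {X : Type*} [MeasurableSpace X]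

/-- Time-restricted integration against `Exp_r`: for `t ≥ 0`,
`∫⁻ 1_{s<t} g(s) dExp_r(s) = ∫⁻_{0<s<t} r e^{-rs} g(s) ds`. [folklore] -/
theorem lintegral_expMeasure_indicator (r t : ℝ) {g : ℝ → ℝ≥0∞}
    (hg : Measurable g) :
    ∫⁻ s, (Iio t).indicator g s ∂(expMeasure r) =
      ∫⁻ s in Ioo 0 t, ENNReal.ofReal (r * Real.exp (-(r * s))) * g s := by
  rw [lintegral_expMeasure r (hg.indicator measurableSet_Iio), ← lintegral_indicator measurableSet_Ioi,
    ← lintegral_indicator measurableSet_Ioo]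
  refine lintegral_congr fun s => ?_
  simp only [indicator, mem_Ioi, mem_Iio, mem_Ioo]
  by_cases h1 : 0 < s <;> by_cases h2 : s < t <;> simp [h1, h2]

/-- `∫₀ᵗ c (t - s)^n ds = c t^{n+1}/(n+1)` in `ℝ≥0∞` form (`t, c ≥ 0`). [folklore] -/
theorem setLIntegral_mul_sub_pow {t c : ℝ} (ht : 0 ≤ t) (hc : 0 ≤ c) (n : ℕ) :
    ∫⁻ s in Ioo 0 t, ENNReal.ofReal (c * (t - s) ^ n) = ENNReal.ofReal (c * t ^ (n + 1) / (n + 1)) := by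
  have hcont : Continuous fun s : ℝ => c * (t - s) ^ n := by fun_prop
  have hint : IntegrableOn (fun s : ℝ => c * (t - s) ^ n) (Ioo 0 t) volume :=
    (hcont.integrableOn_Icc (a := 0) (b := t)).mono_set Ioo_subset_Icc_self
  have hnn : 0 ≤ᵐ[volume.restrict (Ioo 0 t)] fun s : ℝ => c * (t - s) ^ n := by
    rw [EventuallyLE, ae_restrict_iff' measurableSet_Ioo]
    exact Eventually.of_forall fun s hs => mul_nonneg hc (pow_nonneg (by linarith [hs.2]) n)
  rw [← ofReal_integral_eq_lintegral_ofReal hint hnn]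
  congr 1
  rw [← integral_Ioc_eq_integral_Ioo, ← intervalIntegral.integral_of_le ht,
    intervalIntegral.integral_const_mul, intervalIntegral.integral_comp_sub_left (fun s => s ^ n) t,
    sub_self, sub_zero, integral_pow, zero_pow (Nat.succ_ne_zero n), sub_zero]
  ring

section Family

variable (K : Kernel (ℝ × X) X) (Q : Kernel X X) {r : ℝ}
  (hr : 0 < r) (U : ℕ → Kernel (ℝ × X) X)
  (hU0 : ∀ p : ℝ × X, 0 ≤ p.1 → U 0 p = ENNReal.ofReal (Real.exp (-(r * p.1))) • K p)
  (hUsucc : ∀ (n : ℕ) (p : ℝ × X) (f : X → ℝ≥0∞), Measurable f →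
    ∫⁻ z, f z ∂(U (n + 1) p) =
      ∫⁻ s, (Iio p.1).indicator (fun s =>
        ∫⁻ y, ∫⁻ y', ∫⁻ z, f z ∂(K (s, y')) ∂(Q y) ∂(U n (p.1 - s, p.2))) s ∂(expMeasure r))

include hU0 in
/-- The zeroth term integrates as `∫ f dU_0(t, x) = e^{-rt} ∫ f dP_t(x, ·)` (`t ≥ 0`). [folklore] -/
theorem lintegral_U_zero {t : ℝ} (ht : 0 ≤ t) (x : X) (f : X → ℝ≥0∞) :
    ∫⁻ z, f z ∂(U 0 (t, x)) = ENNReal.ofReal (Real.exp (-(r * t))) * ∫⁻ z, f z ∂(K (t, x)) := by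
  rw [hU0 (t, x) ht, lintegral_smul_measure, smul_eq_mul]

include hr hU0 hUsucc in
/-- **Total mass of the `n`-jump term: the Poisson weights.** For `t ≥ 0`,
`U_n(t, x)(X) = e^{-rt} (rt)^n / n!` (the probability of exactly `n` events of the rate-`r` clock in
`[0, t]`; induction on `n` through the last-jump recursion, `K` and `Q` being Markov). [folklore] -/
theorem measure_univ_U [IsMarkovKernel K] [IsMarkovKernel Q] (n : ℕ) {t : ℝ} (ht : 0 ≤ t) (x : X) :
    U n (t, x) univ = ENNReal.ofReal (Real.exp (-(r * t)) * (r * t) ^ n / n.factorial) := by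
  induction n generalizing t x with
  | zero =>
    rw [← lintegral_one, lintegral_U_zero K U hU0 ht x, lintegral_one, measure_univ, mul_one]
    simp
  | succ n ih =>
    rw [← lintegral_one, hUsucc n (t, x) (fun _ => 1) measurable_const]
    simp only [lintegral_one, measure_univ]
    have hih : ∀ s, (Iio t).indicator (fun s => ∫⁻ y, (1 : ℝ≥0∞) ∂(U n (t - s, x))) s =
        (Iio t).indicator (fun s => ENNReal.ofReal
          (Real.exp (-(r * (t - s))) * (r * (t - s)) ^ n / n.factorial)) s := by
      intro s
      by_cases hs : s < t
      · simp only [indicator_of_mem (mem_Iio.2 hs), lintegral_one]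
        exact ih (by linarith) x
      · simp only [indicator_of_notMem (fun h => hs (mem_Iio.1 h))]
    simp_rw [lintegral_one] at hih ⊢
    simp_rw [hih]
    rw [lintegral_expMeasure_indicator r t (by fun_prop)]
    have hpt : ∀ s, ENNReal.ofReal (r * Real.exp (-(r * s))) *
        ENNReal.ofReal (Real.exp (-(r * (t - s))) * (r * (t - s)) ^ n / n.factorial) =
        ENNReal.ofReal (Real.exp (-(r * t)) * r ^ (n + 1) / n.factorial * (t - s) ^ n) := by
      intro s
      rw [mul_pow, ← ENNReal.ofReal_mul (by positivity)]
      congr 1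
      have hexp : Real.exp (-(r * s)) * Real.exp (-(r * (t - s))) = Real.exp (-(r * t)) := by
        rw [← Real.exp_add]; ring_nf
      rw [← hexp]
      set w := (t - s) ^ n
      set e₁ := Real.exp (-(r * s))
      set e₂ := Real.exp (-(r * (t - s)))
      ring
    simp_rw [hpt]
    rw [setLIntegral_mul_sub_pow ht (by positivity) n]
    congr 1
    rw [Nat.factorial_succ]
    push_cast
    field_simp
    ring

include hr hU0 hUsucc in
/-- **The jump expansion has total mass one**: `∑_n U_n(t, x)(X) = 1` for `t ≥ 0` (the Poisson
weights sum to one). [folklore] -/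
theorem hasSum_measure_univ_U [IsMarkovKernel K] [IsMarkovKernel Q] {t : ℝ} (ht : 0 ≤ t) (x : X) :
    HasSum (fun n => U n (t, x) univ) 1 := by
  have h := hasSum_one_poissonMeasure (r * t).toNNReal
  rw [Real.coe_toNNReal _ (mul_nonneg hr.le ht)] at h
  refine ENNReal.summable.hasSum_iff.2 ?_
  simp_rw [measure_univ_U K Q hr U hU0 hUsucc _ ht x]
  rw [← ENNReal.ofReal_tsum_of_nonneg (fun n => by positivity) h.summable, h.tsum_eq,
    ENNReal.ofReal_one]

end Family

/-- **Registered sub-goal `helper_dysonPhillipsMass`** of stmt-AtomisticToContinuum-11976 (brick for stub S3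
`stub_noisyPositiveConductance`): `measure_univ_U` (the Poisson weights of the jump expansion) on the phase
space of the `N`-particle chain, fully quantified and notation-free. [folklore] -/
theorem helper_dysonPhillipsMass : ∀ (N : ℕ) (K : ProbabilityTheory.Kernel (ℝ × Literature.MathematicalPhysics.KineticTheory.HeatConduction.PhaseSpace N) (Literature.MathematicalPhysics.KineticTheory.HeatConduction.PhaseSpace N)) [ProbabilityTheory.IsMarkovKernel K] (Q : ProbabilityTheory.Kernel (Literature.MathematicalPhysics.KineticTheory.HeatConduction.PhaseSpace N) (Literature.MathematicalPhysics.KineticTheory.HeatConduction.PhaseSpace N)) [ProbabilityTheory.IsMarkovKernel Q] (r : ℝ), 0 < r → ∀ (U : ℕ → ProbabilityTheory.Kernel (ℝ × Literature.MathematicalPhysics.KineticTheory.HeatConduction.PhaseSpace N) (Literature.MathematicalPhysics.KineticTheory.HeatConduction.PhaseSpace N)) [∀ n, ProbabilityTheory.IsFiniteKernel (U n)], (∀ p : ℝ × Literature.MathematicalPhysics.KineticTheory.HeatConduction.PhaseSpace N, 0 ≤ p.1 → U 0 p = ENNReal.ofReal (Real.exp (-(r * p.1))) • K p) → (∀ (n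 : ℕ) (p : ℝ × Literature.MathematicalPhysics.KineticTheory.HeatConduction.PhaseSpace N) (f : Literature.MathematicalPhysics.KineticTheory.HeatConduction.PhaseSpace N → ENNReal), Measurable f → MeasureTheory.lintegral (U (n + 1) p) (fun z => f z) = MeasureTheory.lintegral (ProbabilityTheory.expMeasure r) (fun s => (Set.Iio p.1).indicator (fun s => MeasureTheory.lintegral (U n (p.1 - s, p.2)) (fun y => MeasureTheory.lintegral (Q y) (fun y' => MeasureTheory.lintegral (K (s, y')) (fun z => f z)))) s)) → ∀ (n : ℕ) (t : ℝ), 0 ≤ t → ∀ x : Literature.MathematicalPhysics.KineticTheory.HeatConduction.PhaseSpace N, U n (t, x) Set.univ = ENNReal.ofReal (Real.exp (-(r * t)) * (r * t) ^ n / n.factorial) :=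
  fun _ K _ Q _ _ hr U _ hU0 hUsucc n _ ht x => measure_univ_U K Q hr U hU0 hUsucc n ht x

end Summit.AtomisticToContinuum.FouriersLaw.Theorems.VanishingNoiseBound.JumpPerturbation

end
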